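import Mathlib
import HarnessLib
import Summits.MatrixMultiplication.MatrixMultiplication.Theses.FourierTwoFamiliesModP

/-!
# Linear Paley–Sperner codes have rate at most `½ log q` (Chevalley–Warning)
# — crux stmt-MatrixMultiplication-14308 (`PrimeTwoFamilies`), line `Sketch`, stub `stub_paleyCapacity`, lead c3

The registered open stub `stub_paleyCapacity` of the crux (pattern-axis reshape of line `Sketch`,
`Cruxes/PrimeTwoFamilies/Lines/Sketch.lean`) asks for P_q-Sperner codes `W ⊆ 𝔽_q^L` of size `≥ q^{(1-ε)L}`:
every ordered pair of distinct words has a coordinate where the difference is a non-zero square.  Applied to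
both orders, every non-zero difference of two code words has a NON-SQUARE coordinate (and a non-zero-square
one); all known codes of rate above `log tt(P_q)` are LINEAR (the anti-diagonal code `{(x,-x)}` and its
powers, rate `½ log q`; Alon 1998, Sali–Simonyi 1999; in tree: `Literature.Combinatorics.Extremal.
exists_paley_sperner_card_eq`, with the one-bit ceiling `card_le_pow_of_paley_sperner`).

THEOREM (this file): **no linear code does better.**  If `V ≤ 𝔽^L` is a linear subspace over a finite field
`𝔽` of odd or even characteristic in which every non-zero vector has a non-square coordinate, then
`2 · dim V ≤ L`.  Proof: write `V = ker φ` with `φ : 𝔽^L → 𝔽^r`, `r = L - dim V`; if `L > 2r`, the `r`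
quadratic forms `z ↦ φ(z₁², …, z_L²)_j` in `L` variables have degree sum `2r < L`, so by CHEVALLEY–WARNING
their common zero set has cardinality divisible by the characteristic, hence contains some `z ≠ 0`; then
`(z₁², …, z_L²)` is a non-zero vector of `V` all of whose coordinates are squares — contradiction.  For
`q ≡ 3 (mod 4)` the bound is attained (`{(x,-x)}^{L/2}`), so the Sperner capacity of the Paley tournament
restricted to linear (or affine) codes is EXACTLY `½ log q`: the rate `(1-ε) log q` demanded by
`stub_paleyCapacity` cannot come from linear codes (Calderbank–Frankl–Graham–Li–Shepp 1993 proved the case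
`q = 3`: linear codes for the cyclic triangle have capacity `½ log 3 < 1`).

* `exists_ne_zero_sq_mul_sum_eq_zero` — `L > 2r` columns `a_i ∈ 𝔽^r` admit `z ≠ 0` with `Σ z_i² a_i = 0`;
* `exists_ne_zero_mem_ker_forall_isSquare` — kernel form for a linear map `𝔽^L → 𝔽^r`, `L > 2r`;
* `two_mul_finrank_le_of_forall_exists_not_isSquare` — the dimension bound `2 dim V ≤ L`;
* `card_sq_le_of_linear_paleyCode` — `|V|² ≤ q^L` for linear codes over `ZMod q`, `q ≡ 3 (4)`, with the stub's separation property.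
-/

-- single-conjunct summit: the mandated namespace repeats `MatrixMultiplication`.
set_option linter.dupNamespace false

namespace Summit.MatrixMultiplication.MatrixMultiplication.Theorems.PrimeTwoFamilies.LinearPaleyCapacity

open MvPolynomial Finset

/-- **Square-coefficient dependencies (Chevalley–Warning).**  Over a finite field, any `L > 2r` vectors
`a_0, …, a_{L-1} ∈ 𝔽^r` admit a non-trivial vanishing combination `Σ_i z_i² · a_i = 0`, `z ≠ 0` — i.e. a
dependency all of whose coefficients are squares.  (The `r` quadratic forms `Σ_i a_{ij} z_i²` have degree
sum `≤ 2r < L`, so the number of common zeros is divisible by the characteristic and exceeds `1`.) -/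
theorem exists_ne_zero_sq_mul_sum_eq_zero {K : Type*} [Field K] [Fintype K] [DecidableEq K]
    {L r : ℕ} (a : Fin L → Fin r → K) (hL : 2 * r < L) :
    ∃ z : Fin L → K, z ≠ 0 ∧ ∀ j : Fin r, ∑ i, z i ^ 2 * a i j = 0 := by
  classical
  obtain ⟨p, hchar⟩ := CharP.exists K
  haveI : Fact p.Prime := ⟨CharP.char_is_prime K p⟩
  let f : Fin r → MvPolynomial (Fin L) K := fun j => ∑ i, C (a i j) * X i ^ 2
  have hdeg : ∑ j, (f j).totalDegree < Fintype.card (Fin L) := by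
    rw [Fintype.card_fin]
    calc ∑ j, (f j).totalDegree ≤ ∑ _j : Fin r, 2 := by
          refine Finset.sum_le_sum fun j _ => ?_
          refine MvPolynomial.totalDegree_finsetSum_le fun i _ => ?_
          calc (C (a i j) * X i ^ 2).totalDegree ≤ (C (a i j)).totalDegree + (X i ^ 2 : MvPolynomial (Fin L) K).totalDegree :=
                MvPolynomial.totalDegree_mul _ _
            _ ≤ 0 + 2 := by
                gcongr
                · exact (MvPolynomial.totalDegree_C _).le
                · exact (MvPolynomial.totalDegree_pow _ _).trans (by simp)
      _ = 2 * r := by simp [mul_comm]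
      _ < L := hL
  -- evaluation of the quadratic forms
  have heval : ∀ (x : Fin L → K) (j : Fin r), eval x (f j) = ∑ i, x i ^ 2 * a i j := by
    intro x j
    simp only [f, map_sum, map_mul, MvPolynomial.eval_C, map_pow, MvPolynomial.eval_X]
    exact Finset.sum_congr rfl fun i _ => mul_comm _ _
  -- the common zero set contains `0`, and its size is a multiple of `p ≥ 2`
  have hdvd : p ∣ Fintype.card { x : Fin L → K // ∀ j, eval x (f j) = 0 } := by
    convert char_dvd_card_solutions_of_fintype_sum_lt p hdeg
  have h0 : ∀ j, eval (0 : Fin L → K) (f j) = 0 := fun j => by rw [heval]; simp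
  have hcard : 1 < Fintype.card { x : Fin L → K // ∀ j, eval x (f j) = 0 } := by
    have hpos : 0 < Fintype.card { x : Fin L → K // ∀ j, eval x (f j) = 0 } :=
      Fintype.card_pos_iff.mpr ⟨⟨0, h0⟩⟩
    have hp2 : 2 ≤ p := (Fact.out : p.Prime).two_le
    obtain ⟨c, hc⟩ := hdvd
    rcases Nat.eq_zero_or_pos c with h | h
    · rw [hc, h, mul_zero] at hpos; exact absurd hpos (lt_irrefl 0)
    · calc 1 < 2 := one_lt_two
        _ ≤ p * c := le_trans hp2 (Nat.le_mul_of_pos_right p h)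
        _ = _ := hc.symm
  obtain ⟨⟨z, hz⟩, hne⟩ := Fintype.exists_ne_of_one_lt_card hcard ⟨0, h0⟩
  refine ⟨z, fun h => hne (Subtype.ext h), fun j => ?_⟩
  rw [← heval]; exact hz j

/-- **Kernel form.**  For a linear map `φ : 𝔽^L → 𝔽^r` over a finite field with `L > 2r` there is a
non-zero vector in `ker φ` all of whose coordinates are squares. -/
theorem exists_ne_zero_mem_ker_forall_isSquare {K : Type*} [Field K] [Fintype K] [DecidableEq K]
    {L r : ℕ} (φ : (Fin L → K) →ₗ[K] (Fin r → K)) (hL : 2 * r < L) :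
    ∃ x : Fin L → K, x ≠ 0 ∧ φ x = 0 ∧ ∀ i, IsSquare (x i) := by
  classical
  -- columns of `φ`
  let a : Fin L → Fin r → K := fun i => φ (Pi.single i 1)
  obtain ⟨z, hz, hdep⟩ := exists_ne_zero_sq_mul_sum_eq_zero a hL
  refine ⟨fun i => z i ^ 2, ?_, ?_, fun i => ⟨z i, sq (z i)⟩⟩
  · intro h
    apply hz
    funext i
    have := congrFun h i
    simpa using this
  · have hx : (fun i => z i ^ 2) = ∑ i, (z i ^ 2) • (Pi.single i (1 : K) : Fin L → K) := by
      funext k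
      simp [Finset.sum_apply, Pi.single_apply]
    rw [hx, map_sum]
    funext j
    simp only [map_smul, Finset.sum_apply, Pi.smul_apply, smul_eq_mul, Pi.zero_apply]
    exact hdep j

/-- **Linear Paley–Sperner codes have dimension at most `L/2`.**  If every non-zero vector of a linear
subspace `V ≤ 𝔽^L` (finite field `𝔽`) has a coordinate which is NOT a square, then `2 · dim V ≤ L`.
(For `𝔽 = 𝔽_q`, `q ≡ 3 (mod 4)`, equality is attained by `{(x,-x)}^{L/2}`; a linear — or, after
translation, affine — P_q-Sperner code has all non-zero differences with a non-square coordinate, so its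
rate is at most `½ log q`: the `(1-ε) log q` of `stub_paleyCapacity` cannot be reached linearly.) -/
theorem two_mul_finrank_le_of_forall_exists_not_isSquare {K : Type*} [Field K] [Fintype K]
    [DecidableEq K] {L : ℕ} (V : Submodule K (Fin L → K))
    (hV : ∀ v ∈ V, v ≠ 0 → ∃ i, ¬ IsSquare (v i)) :
    2 * Module.finrank K V ≤ L := by
  classical
  by_contra hlt
  have hlt' : L < 2 * Module.finrank K V := not_le.mp hlt
  set r := L - Module.finrank K V with hr
  have hVL : Module.finrank K V ≤ L := by
    simpa using Submodule.finrank_le V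
  have hquot : Module.finrank K ((Fin L → K) ⧸ V) = r := by
    have h := Submodule.finrank_quotient_add_finrank V
    rw [Module.finrank_fin_fun] at h
    omega
  -- `φ : 𝔽^L → 𝔽^r` with kernel `V`
  let e : ((Fin L → K) ⧸ V) ≃ₗ[K] (Fin r → K) :=
    LinearEquiv.ofFinrankEq _ _ (by rw [hquot, Module.finrank_fin_fun])
  let φ : (Fin L → K) →ₗ[K] (Fin r → K) := e.toLinearMap ∘ₗ V.mkQ
  have hker : ∀ x, φ x = 0 ↔ x ∈ V := by
    intro x
    simp only [φ, LinearMap.coe_comp, LinearEquiv.coe_coe, Function.comp_apply,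
      LinearEquiv.map_eq_zero_iff, Submodule.mkQ_apply, Submodule.Quotient.mk_eq_zero]
  have h2r : 2 * r < L := by omega
  obtain ⟨x, hx0, hφ, hsq⟩ := exists_ne_zero_mem_ker_forall_isSquare φ h2r
  obtain ⟨i, hi⟩ := hV x ((hker x).mp hφ) hx0
  exact hi (hsq i)

/-- **Corollary in the vocabulary of `stub_paleyCapacity`.**  Let `q` be a prime with `q ≡ 3 (mod 4)`
and `V ≤ (ZMod q)^L` a LINEAR code in which every ordered pair of distinct words `(u, w)` has a
coordinate `t` with `w t - u t` a non-zero square (the stub's separation property).  Then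
`|V|² ≤ q^L`, i.e. `|V| ≤ q^{L/2}`: linear codes realise rate exactly `½ log q` (attained by
`{(x,-x)}^{L/2}`, `Literature.Combinatorics.Extremal.exists_paley_sperner_card_eq`) and never the
`(1-ε) log q` the stub demands. -/
theorem card_sq_le_of_linear_paleyCode {q : ℕ} [hq : Fact q.Prime] (hq3 : q % 4 = 3) {L : ℕ}
    (V : Submodule (ZMod q) (Fin L → ZMod q))
    (hV : ∀ u ∈ V, ∀ w ∈ V, u ≠ w → ∃ t, u t ≠ w t ∧ IsSquare (w t - u t)) :
    (Nat.card V) ^ 2 ≤ q ^ L := by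
  classical
  -- every non-zero `v ∈ V` has a non-square coordinate: separate the pair `(v, 0)`
  have hns : ∀ v ∈ V, v ≠ 0 → ∃ i, ¬ IsSquare (v i) := by
    intro v hv hv0
    obtain ⟨t, ht, hsq⟩ := hV v hv 0 V.zero_mem hv0
    refine ⟨t, fun hvt => ?_⟩
    -- `0 - v t = -(v t)` and `v t` both squares with `v t ≠ 0` would make `-1` a square
    have hvt0 : v t ≠ 0 := by simpa using ht
    have h1 : IsSquare (-(v t)) := by simpa using hsq
    have h2 : IsSquare ((v t)⁻¹) := isSquare_inv.mpr hvt
    have h3 : IsSquare (-(v t) * (v t)⁻¹) := h1.mul h2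
    rw [neg_mul, mul_inv_cancel₀ hvt0] at h3
    exact (ZMod.exists_sq_eq_neg_one_iff.mp h3) hq3
  have h := two_mul_finrank_le_of_forall_exists_not_isSquare V hns
  have hcardV : Nat.card V = q ^ Module.finrank (ZMod q) V := by
    rw [Module.natCard_eq_pow_finrank (K := ZMod q) (V := V), Nat.card_zmod]
  rw [hcardV, ← pow_mul]
  exact Nat.pow_le_pow_right hq.out.pos (by omega)

end Summit.MatrixMultiplication.MatrixMultiplication.Theorems.PrimeTwoFamilies.LinearPaleyCapacity
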